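import Literature.NumberTheory.Automorphic.ThorneQInfinityModular
import Literature.NumberTheory.Automorphic.TotallyRealModularityX0Fifteen
import Literature.NumberTheory.Automorphic.FLSResidualImageCriteria
import Literature.NumberTheory.Automorphic.LanglandsTunnellModThree
import Literature.NumberTheory.GaloisRepresentations.OddAbsolutelyIrreducibleProofs
import HarnessLib

/-!
# Thorne 2019, Theorem 2 (second alternative) = Thorne 2016, Theorem 7.6: the printed proof,
# formalised modulo its two automorphy lifting theorems (proofs only)

Sibling PROOFS file of `ThorneQInfinityModular.lean` (theorems only: no definition, no named fact;
D-0014 / D-0026) for the named fact `Thorne2019_thm2_five` (vendored for route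
`Langlands/HeptagonalTower`, consumed as `(hT : Thorne2019_thm2_five)` by
`Summits/Langlands/Langlands/Theorems/EisensteinGelfandKirillovSectorComplementEllipticEntry.lean`).

## The printed result and its printed proof (held texts, read 2026-08-17)

* J. A. Thorne, *Elliptic curves over `ℚ_∞` are modular*, J. Eur. Math. Soc. 21 (2019) 1943–1948
  = arXiv:1505.04769 [Thorne2019], p. 4 of the held text `paper:arxiv-1505.04769`, **Theorem 2**:
  "Let `E` be an elliptic curve over a totally real number field `F`, and suppose that (at least)
  one of the following is true: • The representation `ρ̄_{E,3}|_{G_{F(ζ₃)}}` is absolutely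
  irreducible. • `√5 ∉ F`, and `ρ̄_{E,5}` is irreducible. Then `E` is modular."  *Proof* (verbatim):
  "The first part follows from results of Kisin and Langlands–Tunnell, see [Fre13]. The second
  part, in the case where `ρ̄_{E,5}` remains absolutely irreducible on restriction to `G_{F(ζ₅)}`,
  is a consequence of the first part and the 3–5 switch of Wiles, described in loc. cit.. The
  second part in the remaining case is [Tho15]."
* [Tho15] = J. A. Thorne, *Automorphy of some residually dihedral Galois representations*, Math.
  Ann. 364 (2016) 589–648 = arXiv:1504.00994 [Thorne2016], **Theorem 7.6** (= Thm. 1.1; p. 37 of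
  the held text `paper:arxiv-1504.00994`): "Let `F` be a totally real number field, and let `E` be
  an elliptic curve over `F`. Suppose that: 5 is not a square in `F`; and `E` has no `F`-rational
  5-isogeny. Then `E` is modular."  *Proof* (ibid., verbatim): "Let `ρ : G_F → GL₂(ℚ₅)` denote the
  representation associated to the action of Galois on the étale cohomology `H¹(E_{F̄}, ℤ₅)`,
  after a choice of basis. We must show that `ρ` is automorphic. The condition that `E` has no
  `F`-rational 5-isogeny is equivalent to the assertion that `ρ̄` is irreducible, hence absolutely
  irreducible (because of complex conjugation). If `ρ̄|_{G_{F(ζ₅)}}` is absolutely irreducible,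
  then `ρ` is automorphic by [Fre13]. We therefore assume that `ρ̄|_{G_{F(ζ₅)}}` is absolutely
  reducible. It then follows from [Fre13] that the projective image of `ρ` in `PGL₂(𝔽₅)` is
  isomorphic to `𝔽₂ × 𝔽₂`. In particular, `ρ̄|_{G_{F(ζ₅)}}` is non-scalar, as `Gal(F(ζ₅)/F)` is
  cyclic. The hypotheses of Theorem 7.5 are now satisfied, and we deduce the automorphy of `ρ` in
  this case as well."
* **Theorem 7.5** (= Thm. 1.2, the paper's main theorem; p. 36 of the held text): "Let `F` be a
  totally real number field, let `p` be an odd prime, and let `ρ : G_F → GL₂(ℚ̄_p)` be a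
  continuous representation satisfying the following conditions. • The representation `ρ` is
  almost everywhere unramified. • For each place `v | p` of `F`, `ρ|_{G_{F_v}}` is de Rham. For
  each embedding `τ : F ↪ ℚ̄_p`, we have `HT_τ(ρ) = {0, 1}`. • For each complex conjugation
  `c ∈ G_F`, we have `det ρ(c) = -1`. • The residual representation `ρ̄` is absolutely
  irreducible, yet `ρ̄|_{G_{F(ζ_p)}}` is a direct sum of two distinct characters. The unique
  quadratic subfield `K` of `F(ζ_p)/F` is totally real. Then `ρ` is automorphic: there exists a
  cuspidal automorphic representation `π` of `GL₂(𝔸_F)` of weight 2, an isomorphism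
  `ι : ℚ̄_p → ℂ`, and an isomorphism `ρ ≅ r_ι(π)`."

So the named fact `Thorne2019_thm2_five` IS Thorne 2016, Thm. 7.6, and its printed proof consists
of two automorphy lifting theorems — Freitas–Le Hung–Siksek 2015, Thm. 3 at `p = 5` (the tree's
named fact `FLS2015_theorem3`, `FLSResidualImageCriteria.lean`) and Thorne 2016, Thm. 7.5 (NO
carrier in the tree; triage XL: §§3–7 of the source, Taylor–Wiles–Kisin patching without the
Taylor–Wiles hypothesis) — together with three pieces of glue, all PROVED here:
(1) "irreducible, hence absolutely irreducible (because of complex conjugation)";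
(2) the residually dihedral shape: under (1), if `ρ̄|_{G_{F(ζ₅)}}` is absolutely reducible then it
is a direct sum of two DISTINCT characters (Clifford's theorem for the normal subgroup
`ρ̄(G_{F(ζ₅)}) = ρ̄(G_F) ∩ SL₂(𝔽₅)` with cyclic quotient, and "non-scalar, as `Gal(F(ζ₅)/F)` is
cyclic": a scalar restriction would make `ρ̄(G_F)` abelian);
(3) "√5 ∉ F": the quadratic subfield of `F(ζ₅)/F` is `F(√5)`, `√5 = ζ₅ + ζ₅⁴ - ζ₅² - ζ₅³`, which is
totally real.

## What this file proves

* Part I (landed first): `Thorne2019_thm2_five_of_box2022 : Box2022_theorem1_3 → Thorne2019_thm2_five`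
  — Box 2022, Thm. 1.3 (ii) ("(ii) Thorne 2016") is the contrapositive of Thm. 7.6 on the tree's
  carriers (`Thorne2016_theorem7_6`, `TotallyRealModularityX0Fifteen.lean`). This records that the
  two named facts are one debt, but it is CIRCULAR as a route to a proof: Box's (ii) is proved in
  print by citing Thorne 2016.
* Part II (the printed proof): `Thorne2016_theorem7_6_of_dihedralLifting` derives Thm. 7.6 on the
  strong carrier `IsAutomorphicOfWeightZero E` from `FLS2015_theorem3` and from Theorem 7.5 for
  `ρ = ρ_{E,p}` — the latter written out as the explicit hypothesis `hT` (binders symbol for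
  symbol those of `Kalyanswamy2018_theorem1_2`, the `p = 7` analogue; see "Hypothesis (T)" below),
  exactly as `FLS2015_theorem5_of_largeImage` takes FLS Thms. 3–4 as its hypothesis (A). Then
  `Thorne2019_thm2_five_of_dihedralLifting : FLS2015_theorem3 → (T) → Thorne2019_thm2_five`, and,
  for the seat of `Box2022_theorem1_3`, its clause (ii) from any proof of Thm. 7.6
  (`Box2022_theorem1_3_five_of_theorem7_6`). The glue: `Thorne2016.isIrreducible_of_hasIrreducibleModPGaloisRep`
  / `hasIrreducibleModPGaloisRep_of_isIrreducible` (the dictionary "no `F`-rational `p`-isogeny ⇔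
  every framing of `E[p]` is irreducible"), `Thorne2016.isAbsolutelyIrreducible_of_hasIrreducibleModPGaloisRep`
  (1), `Thorne2016.exists_conj_restrictField_mem_diagonalSubgroup` (2),
  `Thorne2016.exists_isTotallyReal_quadratic_five` (3).

## Hypothesis (T): Theorem 7.5 for the `p`-adic representation of an elliptic curve

For `ρ = ρ_{E,p}` (`E` elliptic over the totally real `F`) the first three conditions of Thm. 7.5
hold for every `E` (unramified outside `p Δ(E) ∞`; de Rham with `HT_τ = {0,1}`, the Tate module of
an abelian variety; `det ρ_{E,p} = ε_p⁻¹`, totally odd) — this is how the printed proof of Thm. 7.6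
applies it — so (T) reads, on the tree's carriers: for `F` totally real, `p ≠ 2` prime, `E / 𝓞 F`
with `Δ(E) ≠ 0`, a framing `ρ̄` of the Galois action on `(E ⊗ F)[p]`
(`WeierstrassCurve.IsTorsionGaloisRep`) which is absolutely irreducible, and a model `L` of
`F(ζ_p)` (`IsCyclotomicExtension {p} F L`) such that (a) "`ρ̄|_{G_{F(ζ_p)}}` is a direct sum of
two distinct characters": after a base change `f : 𝔽_p → k` and a change of basis `Q ∈ GL₂(k)`
every `Q ρ̄(τ) Q⁻¹`, `τ ∈ Γ_L`, is diagonal (`Serre1972.diagonalSubgroup k`) and some `τ` has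
distinct diagonal entries, and (b) "the unique quadratic subfield of `F(ζ_p)/F` is totally real":
some field `M`, quadratic over `F` and totally real, embeds `F`-linearly in `L` (`Gal(F(ζ_p)/F)` is
cyclic, so there is at most one quadratic subextension) — `E` is automorphic of weight zero
(`IsAutomorphicOfWeightZero E`, the rendering of "`ρ_{E,p}` automorphic, i.e. `E` modular" shared
by `FLS2015_theorem3`, `Kalyanswamy2018_theorem1_2`). (T) is a HYPOTHESIS of the theorems below,
not a named fact of the tree (D-0026: this proving seat may not mint it; the statement is ready to
be vendored verbatim by a cite item, after which `Thorne2019_thm2_five` is closed modulo it and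
`FLS2015_theorem3` by `Thorne2019_thm2_five_of_dihedralLifting`).

## References

* [Thorne2019] J. Eur. Math. Soc. 21 (2019) 1943–1948, doi:10.4171/jems/877, Thm. 2 and its proof
  (p. 4 of the held text `paper:arxiv-1505.04769`).
* [Thorne2016] Math. Ann. 364 (2016) 589–648, doi:10.1007/s00208-015-1214-z, Thm. 7.6 (= Thm. 1.1)
  and its proof, Thm. 7.5 (= Thm. 1.2), §2 ("weight 2", `r_ι(π)`) — pp. 3, 5–6, 36–37 of the held
  text `paper:arxiv-1504.00994`.
* [Box2022] Trans. Amer. Math. Soc. 375 (2022), Thm. 1.3 (ii) (tree: `Box2022_theorem1_3`).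
* [FreitasLeHungSiksek2015] Invent. Math. 201 (2015) 159–206, Thm. 3, Prop. 4.1 (i) (tree:
  `FLS2015_theorem3`, `range_restrictField_cyclotomic_eq_of_det`).
* [Serre1972] Invent. Math. 15 (1972), §2.1 (Cartan subgroups; tree `Serre1972.diagonalSubgroup`).
-/

open scoped NumberField MatrixGroups IntermediateField
open NumberField Field Matrix Polynomial Literature.NumberTheory.GaloisRepresentations

noncomputable section

namespace Literature.NumberTheory.Automorphic

universe u v

/-! ## Part I. The fact is one debt with `Box2022_theorem1_3` (ii) -/

/-- **Thorne 2019, Thm. 2 (second alternative) from Box 2022, Thm. 1.3 (ii).** The named fact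
`Thorne2019_thm2_five` — for `K` a totally real number field with `√5 ∉ K` and `E / 𝓞 K` with
`Δ(E) ≠ 0` whose mod-`5` representation is irreducible (`HasIrreducibleModPGaloisRep 5`: no
`Γ_K`-stable subgroup of `E[5]` other than `⊥`, `⊤`), `E` is modular in the Caraiani–Newton sense
`IsModularEllipticCurve K E` — follows from the named fact `Box2022_theorem1_3` (ii): this is
`Thorne2016_theorem7_6_isModularEllipticCurve` (`TotallyRealModularityX0Fifteen.lean`; Thorne
2019, Thm. 2, second bullet = Thorne 2016, Thm. 7.6) with the instance hypothesis `IsTotallyReal K`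
made explicit, as the fact states it. The two facts are therefore one debt.
[cite: Thorne2019, Thm. 2 (proof: "[Tho15]" = Thorne 2016, Thm. 7.6)] -/
theorem Thorne2019_thm2_five_of_box2022 (hB : Box2022_theorem1_3) : Thorne2019_thm2_five := by
  intro K _ _ hK h5 E hΔ hirr
  haveI := hK
  exact Thorne2016_theorem7_6_isModularEllipticCurve hB K h5 E hΔ hirr

/-- **The strong form behind the fact.** Under `Box2022_theorem1_3`, the hypotheses of
`Thorne2019_thm2_five` (with `IsTotallyReal K` explicit) already give the tree's STRONG rendering of
"modular", `IsAutomorphicOfWeightZero E` (a weight-zero cuspidal `π` of `GL₂(𝔸_K)` with Hecke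
polynomial `X² - a_w X + q_w` at every `w ∤ Δ(E)`), of which the fact's conclusion
`IsModularEllipticCurve K E` is the cofinite trace shadow
(`IsModularEllipticCurve.of_isAutomorphicOfWeightZero`). This is `Thorne2016_theorem7_6` with the
instance made explicit; recorded so that consumers of the fact who need the Euler factors can
upgrade along the same debt. [cite: Thorne2016, Thm. 7.6] -/
theorem Thorne2019_thm2_five.isAutomorphicOfWeightZero_of_box2022 (hB : Box2022_theorem1_3)
    (K : Type) [Field K] [NumberField K] (hK : IsTotallyReal K) (h5 : ¬ IsSquare (5 : K))
    (E : WeierstrassCurve (𝓞 K)) (hΔ : E.Δ ≠ 0)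
    (hirr : (E.baseChange K).HasIrreducibleModPGaloisRep 5) : IsAutomorphicOfWeightZero E := by
  haveI := hK
  exact Thorne2016_theorem7_6 hB K h5 E hΔ hirr

/-! ## Part II. The printed proof of Thm. 7.6, modulo [Fre13] and Thm. 7.5

All glue is proved; the two automorphy lifting theorems enter as `h3 : FLS2015_theorem3` and as
the written-out hypothesis (T) (module docstring). -/

namespace Thorne2016

/-! ### Step 1: no `F`-rational `p`-isogeny ⇒ `ρ̄` irreducible ⇒ absolutely irreducible -/

/-- **"The condition that `E` has no `F`-rational `p`-isogeny is equivalent to the assertion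
that `ρ̄` is irreducible"** (Thorne 2016, proof of Thm. 7.6), direction used: if the only
`Γ_F`-stable subgroups of `E[p]` are `0` and `E[p]` (`HasIrreducibleModPGaloisRep`), every framing
`ρ̄` of `E[p]` is irreducible — a reducible framing is upper triangular after a change of framing
(`FLS2015.exists_isTorsionGaloisRep_borel_of_not_isIrreducible`) and then exhibits a stable line
(`not_hasIrreducibleModPGaloisRep_of_isTorsionGaloisRep_borel`). Any field `F`.
[cite: Thorne2016, proof of Thm. 7.6] -/
theorem isIrreducible_of_hasIrreducibleModPGaloisRep {F : Type u} [Field F]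
    {W : WeierstrassCurve F} {p : ℕ} [Fact p.Prime] (hirr : W.HasIrreducibleModPGaloisRep p)
    {ρ : FramedGaloisRep F (ZMod p) 2} (hρ : W.IsTorsionGaloisRep p ρ) :
    FramedRep.IsIrreducible ρ := by
  by_contra h
  obtain ⟨ρ', hρ', hB⟩ := FLS2015.exists_isTorsionGaloisRep_borel_of_not_isIrreducible hρ h
  exact not_hasIrreducibleModPGaloisRep_of_isTorsionGaloisRep_borel hρ' hB hirr

/-- **"… hence absolutely irreducible (because of complex conjugation)"** (Thorne 2016, proof of
Thm. 7.6; glue (1) of the module docstring). For an elliptic curve `W` over a totally real number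
field `K` and an odd prime `p`, if `E[p]` has no proper non-zero `Γ_K`-stable subgroup then every
framing `ρ̄` of `E[p]` is absolutely irreducible: `det ρ̄ = χ̄_p` (Weil pairing,
`det_eq_modPCyclotomicCharacter_of_isTorsionGaloisRep_holds`), a complex conjugation `c`
(`exists_isComplexConjugation` at a real place) has `c² = 1` and `χ̄_p(c) = -1`, and an irreducible
plane representation containing such an involution is absolutely irreducible when `2 ≠ 0`
(`FramedRep.isAbsolutelyIrreducible_of_isIrreducible_of_det_eq_neg_one`).
[cite: Thorne2016, proof of Thm. 7.6] -/
theorem isAbsolutelyIrreducible_of_hasIrreducibleModPGaloisRep {K : Type u} [Field K]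
    [NumberField K] [IsTotallyReal K] (W : WeierstrassCurve K) [W.IsElliptic] {p : ℕ}
    [Fact p.Prime] (hp2 : p ≠ 2) (hirr : W.HasIrreducibleModPGaloisRep p)
    {ρ : ModPGaloisRep K (ZMod p) 2} (hρ : W.IsTorsionGaloisRep p ρ) :
    FramedRep.IsAbsolutelyIrreducible ρ := by
  have hp : p.Prime := Fact.out
  haveI : NeZero ((p : ℕ) : K) := NeZero.charZero
  obtain ⟨φ⟩ := FLS2015.exists_realEmbedding K
  obtain ⟨c, hc⟩ := exists_isComplexConjugation φ
  have hcc : c * c = 1 := by rw [← pow_two]; exact hc.sq_eq_one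
  have h2 : (2 : ZMod p) ≠ 0 := by
    change ((2 : ℕ) : ZMod p) ≠ 0
    rw [Ne, ZMod.natCast_eq_zero_iff]
    intro h
    exact hp2 ((Nat.prime_dvd_prime_iff_eq hp Nat.prime_two).mp h)
  refine FramedRep.isAbsolutelyIrreducible_of_isIrreducible_of_det_eq_neg_one ρ
    (isIrreducible_of_hasIrreducibleModPGaloisRep hirr hρ) h2 hcc ?_
  rw [W.det_eq_modPCyclotomicCharacter_of_isTorsionGaloisRep_holds p ρ hρ c,
    modPCyclotomicCharacterZMod_eq_modNCyclotomicCharacter]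
  ext
  simpa using modNCyclotomicCharacter_of_isComplexConjugation (N := p) hc

/-! ### Step 2 (Clifford): the dihedral shape of `ρ̄|Γ_{K(ζ_p)}` -/

/-- **The residually dihedral shape (glue (2)): `ρ̄` absolutely irreducible and
`ρ̄|_{Γ_{K(ζ_p)}}` absolutely reducible ⇒ `ρ̄|_{Γ_{K(ζ_p)}}` is a direct sum of two DISTINCT
characters.** Let `ρ̄ : Γ_K →ₜ* GL₂(𝔽_p)` (`char K = 0`) have `det ρ̄ = χ̄_p` and be absolutely
irreducible, and let `L` be a model of `K(ζ_p)` with `ρ̄|_{Γ_L}` not absolutely irreducible. Then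
for some field `k`, `f : 𝔽_p →+* k` and `Q ∈ GL₂(k)`, every `Q f(ρ̄(τ)) Q⁻¹` (`τ ∈ Γ_L`) is
diagonal and some `τ` has distinct diagonal entries. Proof (Clifford): over the field `k ⊇ 𝔽_p`
where `N = ρ̄(Γ_L) = {g ∈ ρ̄(Γ_K) ; det g = 1}` (FLS Prop. 4.1 (i),
`mem_range_absGaloisRestrict_cyclotomic_iff`) has a common eigenvector `v`
(`exists_eigenvector_of_det_eq_one_of_not_isAbsolutelyIrreducible_restrictField`), irreducibility of
`ρ̄ ⊗ k` gives `σ₀` with `w = ρ̄(σ₀) v ∉ k v` (`FramedRep.exists_mulVec_ne_smul_of_isIrreducible`);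
`N` being normal, `w` is again a common eigenvector of `N`, so `N` is diagonal in the basis
`(v, w)`. If the two diagonal characters agreed, `N` would be scalar, hence central in
`G = ρ̄(Γ_K)`, and `G/N ↪ 𝔽_pˣ` cyclic would make `G` abelian
(`MonoidHom.isMulCommutative_of_isCyclic_of_ker_le_center`), contradicting absolute irreducibility
(`FramedRep.exists_mul_ne_mul_of_isAbsolutelyIrreducible`) — Thorne: "`ρ̄|_{G_{F(ζ₅)}}` is
non-scalar, as `Gal(F(ζ₅)/F)` is cyclic". [cite: Thorne2016, proof of Thm. 7.6 and §1 ("necessarily induced from the unique index 2 subgroup")] -/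
theorem exists_conj_restrictField_mem_diagonalSubgroup {K : Type u} [Field K] [CharZero K]
    {p : ℕ} [Fact p.Prime] (ρ : FramedGaloisRep K (ZMod p) 2)
    (hdet : ∀ σ, Matrix.GeneralLinearGroup.det (ρ σ) = modPCyclotomicCharacterZMod K p σ)
    (habs : FramedRep.IsAbsolutelyIrreducible ρ)
    (L : Type v) [Field L] [Algebra K L] [IsCyclotomicExtension {p} K L]
    (hred : ¬ FramedRep.IsAbsolutelyIrreducible (ρ.restrictField L)) :
    ∃ (k : Type) (_ : Field k) (f : ZMod p →+* k) (Q : GL (Fin 2) k),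
      (∀ τ : absoluteGaloisGroup L,
        Q * Matrix.GeneralLinearGroup.map f (ρ.restrictField L τ) * Q⁻¹ ∈
          Serre1972.diagonalSubgroup k) ∧
      ∃ τ : absoluteGaloisGroup L,
        ((Q * Matrix.GeneralLinearGroup.map f (ρ.restrictField L τ) * Q⁻¹ : GL (Fin 2) k) :
            Matrix (Fin 2) (Fin 2) k) 0 0 ≠
          ((Q * Matrix.GeneralLinearGroup.map f (ρ.restrictField L τ) * Q⁻¹ : GL (Fin 2) k) :
            Matrix (Fin 2) (Fin 2) k) 1 1 := by
  classical
  haveI : NeZero ((p : ℕ) : K) := NeZero.charZero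
  obtain ⟨B, _, f, v, hv0, hB⟩ :=
    exists_eigenvector_of_det_eq_one_of_not_isAbsolutelyIrreducible_restrictField ρ hdet L hred
  -- the base change `ρ_B = f ∘ ρ` as a framed representation over the discrete field `B`
  letI : TopologicalSpace B := ⊥
  haveI : DiscreteTopology B := ⟨rfl⟩
  have hirrB : FramedRep.IsIrreducible (ρ.baseChange f continuous_of_discreteTopology) := habs B f
  have hmapval : ∀ σ, ((Matrix.GeneralLinearGroup.map f (ρ σ) : GL (Fin 2) B) :
      Matrix (Fin 2) (Fin 2) B) = ((ρ σ : GL (Fin 2) (ZMod p)) : Matrix (Fin 2) (Fin 2) (ZMod p)).map f :=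
    fun σ => rfl
  -- `v` is an eigenvector of every determinant-one `ρ σ`
  have hBv : ∀ σ, Matrix.GeneralLinearGroup.det (ρ σ) = 1 → ∃ a : B,
      ((Matrix.GeneralLinearGroup.map f (ρ σ) : GL (Fin 2) B) : Matrix (Fin 2) (Fin 2) B) *ᵥ v =
        a • v := fun σ hσ => hB σ hσ
  -- Clifford: a vector `w = ρ(σ₀) v` outside the line of `v` …
  obtain ⟨σ₀, hσ₀⟩ := FramedRep.exists_mulVec_ne_smul_of_isIrreducible _ hirrB hv0
  simp only [FramedRep.baseChange_apply] at hσ₀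
  set w : Fin 2 → B :=
    ((Matrix.GeneralLinearGroup.map f (ρ σ₀) : GL (Fin 2) B) : Matrix (Fin 2) (Fin 2) B) *ᵥ v
    with hw
  -- … which is again a common eigenvector of the normal subgroup of determinant-one elements
  have hdet_conj : ∀ σ, Matrix.GeneralLinearGroup.det (ρ (σ₀⁻¹ * σ * σ₀)) =
      Matrix.GeneralLinearGroup.det (ρ σ) := by
    intro σ
    rw [map_mul, map_mul, map_mul, map_mul, map_inv, map_inv, inv_mul_cancel_comm]
  have hBw : ∀ σ, Matrix.GeneralLinearGroup.det (ρ σ) = 1 → ∃ a : B,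
      ((Matrix.GeneralLinearGroup.map f (ρ σ) : GL (Fin 2) B) : Matrix (Fin 2) (Fin 2) B) *ᵥ w =
        a • w := by
    intro σ hσ
    obtain ⟨a, ha⟩ := hBv (σ₀⁻¹ * σ * σ₀) (by rw [hdet_conj]; exact hσ)
    refine ⟨a, ?_⟩
    have hmul : Matrix.GeneralLinearGroup.map f (ρ σ) * Matrix.GeneralLinearGroup.map f (ρ σ₀) =
        Matrix.GeneralLinearGroup.map f (ρ σ₀) *
          Matrix.GeneralLinearGroup.map f (ρ (σ₀⁻¹ * σ * σ₀)) := by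
      rw [← map_mul, ← map_mul, ← map_mul, ← map_mul]
      congr 1
      group
    calc ((Matrix.GeneralLinearGroup.map f (ρ σ) : GL (Fin 2) B) : Matrix (Fin 2) (Fin 2) B) *ᵥ w
        = (((Matrix.GeneralLinearGroup.map f (ρ σ) * Matrix.GeneralLinearGroup.map f (ρ σ₀) :
            GL (Fin 2) B)) : Matrix (Fin 2) (Fin 2) B) *ᵥ v := by
          rw [hw, Matrix.mulVec_mulVec, Units.val_mul]
      _ = ((Matrix.GeneralLinearGroup.map f (ρ σ₀) : GL (Fin 2) B) : Matrix (Fin 2) (Fin 2) B) *ᵥ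
            (((Matrix.GeneralLinearGroup.map f (ρ (σ₀⁻¹ * σ * σ₀)) : GL (Fin 2) B) :
              Matrix (Fin 2) (Fin 2) B) *ᵥ v) := by
          rw [hmul, Units.val_mul, Matrix.mulVec_mulVec]
      _ = a • w := by rw [ha, Matrix.mulVec_smul, hw]
  -- `(v, w)` is a basis: the matrix `P` with columns `v`, `w` is invertible
  have hPdet : Matrix.det !![v 0, w 0; v 1, w 1] ≠ 0 := by
    intro h0
    rw [Matrix.det_fin_two_of] at h0
    by_cases hv : v 0 = 0
    · have hv1 : v 1 ≠ 0 := by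
        intro hv1
        apply hv0
        funext i
        fin_cases i
        · exact hv
        · exact hv1
      have hw0 : w 0 = 0 := by
        rw [hv, zero_mul, zero_sub, neg_eq_zero] at h0
        exact (mul_eq_zero.1 h0).resolve_right hv1
      refine hσ₀ (w 1 / v 1) ?_
      funext i
      fin_cases i
      · simp [hv, hw0]
      · simp [div_mul_cancel₀ _ hv1]
    · refine hσ₀ (w 0 / v 0) ?_
      funext i
      fin_cases i
      · simp [div_mul_cancel₀ _ hv]
      · change w 1 = w 0 / v 0 * v 1
        field_simp
        linear_combination h0
  set P : GL (Fin 2) B := Matrix.GeneralLinearGroup.mkOfDetNeZero _ hPdet with hP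
  have hPe0 : (P : Matrix (Fin 2) (Fin 2) B) *ᵥ Pi.single 0 1 = v := by
    funext i
    fin_cases i <;>
      simp [hP, Matrix.GeneralLinearGroup.mkOfDetNeZero, Matrix.mulVec, dotProduct,
        Pi.single_apply]
  have hPe1 : (P : Matrix (Fin 2) (Fin 2) B) *ᵥ Pi.single 1 1 = w := by
    funext i
    fin_cases i <;>
      simp [hP, Matrix.GeneralLinearGroup.mkOfDetNeZero, Matrix.mulVec, dotProduct,
        Pi.single_apply]
  have hPinv_v : ((P⁻¹ : GL (Fin 2) B) : Matrix (Fin 2) (Fin 2) B) *ᵥ v = Pi.single 0 1 := by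
    rw [← hPe0, Matrix.mulVec_mulVec, ← Units.val_mul, inv_mul_cancel, Units.val_one,
      Matrix.one_mulVec]
  have hPinv_w : ((P⁻¹ : GL (Fin 2) B) : Matrix (Fin 2) (Fin 2) B) *ᵥ w = Pi.single 1 1 := by
    rw [← hPe1, Matrix.mulVec_mulVec, ← Units.val_mul, inv_mul_cancel, Units.val_one,
      Matrix.one_mulVec]
  -- in the basis `(v, w)` every determinant-one `ρ σ` is diagonal
  have hdiag : ∀ σ, Matrix.GeneralLinearGroup.det (ρ σ) = 1 →
      GL2.IsDg (((P⁻¹ * Matrix.GeneralLinearGroup.map f (ρ σ) * P : GL (Fin 2) B)) :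
        Matrix (Fin 2) (Fin 2) B) := by
    intro σ hσ
    obtain ⟨a, ha⟩ := hBv σ hσ
    obtain ⟨b, hb⟩ := hBw σ hσ
    have h0 : ((P⁻¹ * Matrix.GeneralLinearGroup.map f (ρ σ) * P : GL (Fin 2) B) :
        Matrix (Fin 2) (Fin 2) B) *ᵥ Pi.single 0 1 = a • Pi.single 0 1 := by
      rw [Units.val_mul, Units.val_mul, ← Matrix.mulVec_mulVec, ← Matrix.mulVec_mulVec, hPe0, ha,
        Matrix.mulVec_smul, hPinv_v]
    have h1 : ((P⁻¹ * Matrix.GeneralLinearGroup.map f (ρ σ) * P : GL (Fin 2) B) :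
        Matrix (Fin 2) (Fin 2) B) *ᵥ Pi.single 1 1 = b • Pi.single 1 1 := by
      rw [Units.val_mul, Units.val_mul, ← Matrix.mulVec_mulVec, ← Matrix.mulVec_mulVec, hPe1, hb,
        Matrix.mulVec_smul, hPinv_w]
    constructor
    · have := congr_fun h1 0
      simpa [Matrix.mulVec, dotProduct, Fin.sum_univ_two, Pi.single_apply] using this
    · have := congr_fun h0 1
      simpa [Matrix.mulVec, dotProduct, Fin.sum_univ_two, Pi.single_apply] using this
  have hdet1 : ∀ τ : absoluteGaloisGroup L,
      Matrix.GeneralLinearGroup.det (ρ (absGaloisRestrict K L τ)) = 1 := fun τ => by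
    rw [hdet]
    exact (mem_range_absGaloisRestrict_cyclotomic_iff p L _).1 ⟨τ, rfl⟩
  refine ⟨B, inferInstance, f, P⁻¹, fun τ => ?_, ?_⟩
  · rw [Serre1972.mem_diagonalSubgroup_iff, inv_inv, FramedGaloisRep.restrictField_apply]
    exact hdiag _ (hdet1 τ)
  -- the two diagonal characters are distinct: otherwise `ρ(Γ_K) ∩ SL₂` is scalar, `ρ(Γ_K)` is
  -- abelian (cyclic quotient by a central subgroup), contradicting absolute irreducibility
  by_contra hall
  push Not at hall
  have hscalar : ∀ σ, Matrix.GeneralLinearGroup.det (ρ σ) = 1 →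
      ∃ d : ZMod p, ((ρ σ : GL (Fin 2) (ZMod p)) : Matrix (Fin 2) (Fin 2) (ZMod p)) = d • 1 := by
    intro σ hσ
    have hχ : modPCyclotomicCharacterZMod K p σ = 1 := by rw [← hdet, hσ]
    obtain ⟨τ, hτ⟩ := mem_range_absGaloisRestrict_of_modPCyclotomicCharacterZMod_eq_one K p L hχ
    have hτ' : absGaloisRestrict K L τ = σ := hτ
    have hd := hdiag σ hσ
    have heq := hall τ
    rw [inv_inv, FramedGaloisRep.restrictField_apply, hτ'] at heq
    set Y : Matrix (Fin 2) (Fin 2) B :=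
      ((P⁻¹ * Matrix.GeneralLinearGroup.map f (ρ σ) * P : GL (Fin 2) B) : Matrix (Fin 2) (Fin 2) B)
      with hY
    obtain ⟨c, hYc⟩ : ∃ c : B, Y = c • (1 : Matrix (Fin 2) (Fin 2) B) := by
      refine ⟨Y 0 0, ?_⟩
      ext i j
      fin_cases i <;> fin_cases j
      · simp
      · simpa using hd.1
      · simpa using hd.2
      · simpa using heq.symm
    have hM : ((Matrix.GeneralLinearGroup.map f (ρ σ) : GL (Fin 2) B) : Matrix (Fin 2) (Fin 2) B) =
        c • (1 : Matrix (Fin 2) (Fin 2) B) := by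
      have hg : Matrix.GeneralLinearGroup.map f (ρ σ) =
          P * (P⁻¹ * Matrix.GeneralLinearGroup.map f (ρ σ) * P) * P⁻¹ := by group
      rw [hg, Units.val_mul, Units.val_mul, ← hY, hYc, Matrix.mul_smul, Matrix.mul_one,
        Matrix.smul_mul, ← Units.val_mul, mul_inv_cancel, Units.val_one]
    refine ⟨((ρ σ : GL (Fin 2) (ZMod p)) : Matrix (Fin 2) (Fin 2) (ZMod p)) 0 0, ?_⟩
    have hent : ∀ i j, f (((ρ σ : GL (Fin 2) (ZMod p)) : Matrix (Fin 2) (Fin 2) (ZMod p)) i j) =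
        (c • (1 : Matrix (Fin 2) (Fin 2) B)) i j := fun i j => by
      rw [← hM, hmapval, Matrix.map_apply]
    ext i j
    fin_cases i <;> fin_cases j
    · simp
    · apply f.injective
      simpa using hent 0 1
    · apply f.injective
      simpa using hent 1 0
    · apply f.injective
      have h00 := hent 0 0
      have h11 := hent 1 1
      simp at h00 h11 ⊢
      rw [h11, h00]
  have hcomm : ∀ σ₁ σ₂, ρ σ₁ * ρ σ₂ = ρ σ₂ * ρ σ₁ := by
    let G : Subgroup (GL (Fin 2) (ZMod p)) := ρ.toMonoidHom.range
    let fdet : G →* (ZMod p)ˣ := (Matrix.GeneralLinearGroup.det).comp G.subtype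
    have hker : fdet.ker ≤ Subgroup.center G := by
      rintro ⟨_, σ, rfl⟩ hx
      rw [MonoidHom.mem_ker] at hx
      change Matrix.GeneralLinearGroup.det (ρ σ) = 1 at hx
      obtain ⟨d, hd⟩ := hscalar σ hx
      rw [Subgroup.mem_center_iff]
      rintro ⟨g, hg⟩
      apply Subtype.ext
      change g * ρ σ = ρ σ * g
      apply Units.ext
      rw [Units.val_mul, Units.val_mul, hd, Matrix.mul_smul, Matrix.mul_one, Matrix.smul_mul,
        Matrix.one_mul]
    haveI : IsCyclic (ZMod p)ˣ := ZMod.isCyclic_units_prime Fact.out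
    have hG : IsMulCommutative G := fdet.isMulCommutative_of_isCyclic_of_ker_le_center hker
    intro σ₁ σ₂
    have h := hG.is_comm.comm ⟨ρ σ₁, σ₁, rfl⟩ ⟨ρ σ₂, σ₂, rfl⟩
    exact congrArg Subtype.val h
  obtain ⟨g, g', hne⟩ := FramedRep.exists_mul_ne_mul_of_isAbsolutelyIrreducible ρ habs
  exact hne (hcomm g g')

/-! ### Step 3: the quadratic subfield `F(√5)` of `F(ζ₅)/F` is totally real -/

/-- A complex number whose square is `5` is real (its imaginary part vanishes). [folklore] -/
theorem conj_eq_of_sq_eq_five {z : ℂ} (hz : z ^ 2 = 5) : starRingEnd ℂ z = z := by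
  rw [Complex.conj_eq_iff_im]
  have hre : z.re * z.re - z.im * z.im = 5 := by
    have := congrArg Complex.re hz
    simpa [pow_two, Complex.mul_re] using this
  have him : 2 * (z.re * z.im) = 0 := by
    have := congrArg Complex.im hz
    simp [pow_two, Complex.mul_im] at this
    linarith
  rcases mul_eq_zero.1 him with h | h
  · norm_num at h
  rcases mul_eq_zero.1 h with h | h
  · exfalso
    rw [h] at hre
    nlinarith [mul_self_nonneg z.im]
  · exact h

/-- **Glue (3): for `F` totally real with `√5 ∉ F`, the quadratic subfield of `F(ζ₅)/F` is
totally real.** For any model `L` of `F(ζ₅)` there is a field `M`, quadratic over `F` and totally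
real, with an `F`-embedding into `L`: `M = F(g) ⊆ L` for the Gauss sum `g = ζ + ζ⁴ - ζ² - ζ³` of a
primitive fifth root of unity `ζ ∈ L`, which satisfies `g² = 5`; `X² - 5` is irreducible over `F`
(`5` is not a square), so `[F(g) : F] = 2` (`IntermediateField.adjoin.finrank`); and every
embedding `φ : F(g) → ℂ` is real, being real on `F` (`IsTotallyReal.complexEmbedding_isReal`) and
at `g` (`φ(g)² = 5`), which generate (`PowerBasis.algHom_ext`). This is the hypothesis "the unique
quadratic subfield `K` of `F(ζ_p)/F` is totally real" of Thm. 7.5 at `p = 5`, i.e. the hypothesis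
"5 is not a square in `F`" of Thm. 7.6. [cite: Thorne2016, Thm. 7.6 (hypothesis) and Thm. 7.5] -/
theorem exists_isTotallyReal_quadratic_five (F : Type) [Field F] [NumberField F]
    [IsTotallyReal F] (h5 : ¬ IsSquare (5 : F)) (L : Type) [Field L] [Algebra F L]
    [IsCyclotomicExtension {5} F L] :
    ∃ (M : Type) (_ : Field M) (_ : Algebra F M),
      Module.finrank F M = 2 ∧ IsTotallyReal M ∧ Nonempty (M →ₐ[F] L) := by
  haveI : Module.Finite F L := IsCyclotomicExtension.finite {5} F L
  obtain ⟨ζ, hζ⟩ := IsCyclotomicExtension.exists_isPrimitiveRoot F L (Set.mem_singleton 5)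
    (by norm_num)
  have hΦ : 1 + ζ + ζ ^ 2 + ζ ^ 3 + ζ ^ 4 = 0 := by
    have := hζ.geom_sum_eq_zero (by norm_num : 1 < 5)
    simp only [Finset.sum_range_succ, Finset.sum_range_zero, zero_add, pow_zero, pow_one] at this
    exact this
  -- the Gauss sum `g = ζ + ζ⁴ - ζ² - ζ³`, `g² = 5`
  set g : L := ζ + ζ ^ 4 - ζ ^ 2 - ζ ^ 3 with hg
  have hg2 : g ^ 2 = 5 := by
    simp only [hg]
    linear_combination (ζ ^ 4 - 3 * ζ ^ 3 + ζ ^ 2 + 5 * ζ - 5) * hΦ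
  -- `minpoly_F g = X² - 5` (irreducible as `5` is not a square in `F`)
  have hirr : Irreducible (X ^ 2 - C (5 : F)) :=
    X_pow_sub_C_irreducible_of_prime Nat.prime_two fun b hb => h5 ⟨b, by rw [← sq, hb]⟩
  have hmonic : (X ^ 2 - C (5 : F)).Monic := monic_X_pow_sub_C _ two_ne_zero
  have hroot : aeval g (X ^ 2 - C (5 : F)) = 0 := by
    simp [hg2, map_ofNat]
  have hint : IsIntegral F g := Algebra.IsIntegral.isIntegral g
  have hmin : minpoly F g = X ^ 2 - C (5 : F) :=
    (minpoly.eq_of_irreducible_of_monic hirr hroot hmonic).symm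
  have hdeg : (minpoly F g).natDegree = 2 := by
    rw [hmin, natDegree_X_pow_sub_C]
  -- `M = F(g) ⊆ L`
  refine ⟨F⟮g⟯, inferInstance, inferInstance, ?_, ?_, ⟨F⟮g⟯.val⟩⟩
  · rw [IntermediateField.adjoin.finrank hint, hdeg]
  · -- every complex embedding of `F(g)` is real: it is real on `F` and `φ(g)² = 5`
    refine ⟨fun w => ?_⟩
    rw [← InfinitePlace.mk_embedding w, InfinitePlace.isReal_mk_iff, ComplexEmbedding.isReal_iff]
    set φ : F⟮g⟯ →+* ℂ := w.embedding with hφ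
    set ψ : F →+* ℂ := φ.comp (algebraMap F F⟮g⟯) with hψ
    have hψreal : ComplexEmbedding.IsReal ψ := IsTotallyReal.complexEmbedding_isReal ψ
    have hψconj : ∀ x, starRingEnd ℂ (ψ x) = ψ x := fun x =>
      RingHom.congr_fun (ComplexEmbedding.isReal_iff.mp hψreal) x
    letI : Algebra F ℂ := ψ.toAlgebra
    let φ₁ : F⟮g⟯ →ₐ[F] ℂ := { φ with commutes' := fun x => rfl }
    let φ₂ : F⟮g⟯ →ₐ[F] ℂ :=
      { ComplexEmbedding.conjugate φ with
        commutes' := fun x => by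
          change starRingEnd ℂ (φ (algebraMap F F⟮g⟯ x)) = ψ x
          exact hψconj x }
    set pb := IntermediateField.adjoin.powerBasis hint with hpb
    have hgen : φ₁ pb.gen = φ₂ pb.gen := by
      rw [hpb, IntermediateField.adjoin.powerBasis_gen]
      change φ (IntermediateField.AdjoinSimple.gen F g) =
        starRingEnd ℂ (φ (IntermediateField.AdjoinSimple.gen F g))
      refine (conj_eq_of_sq_eq_five ?_).symm
      rw [← map_pow]
      have h2 : (IntermediateField.AdjoinSimple.gen F g) ^ 2 = 5 := by
        apply Subtype.ext
        rw [SubmonoidClass.coe_pow, IntermediateField.AdjoinSimple.coe_gen, hg2]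
        norm_cast
      rw [h2, map_ofNat]
    have h12 : φ₁ = φ₂ := PowerBasis.algHom_ext pb hgen
    refine RingHom.ext fun x => ?_
    have := AlgHom.congr_fun h12 x
    exact this.symm

/-! ### Irreducible framings give back `HasIrreducibleModPGaloisRep` -/

/-- **The converse dictionary: an irreducible framing makes `E[p]` irreducible.** If some framing
`ρ̄` of the Galois action on `E[p]` (`IsTorsionGaloisRep`, frame `e : E[p] ≃ 𝔽_p²`) is irreducible,
then the only `Γ_F`-stable subgroups of `E[p]` are `0` and `E[p]`: the image under `e` of a stable
subgroup is an `𝔽_p`-subspace (`AddSubgroup.toZModSubmodule`) stable under every `ρ̄(σ)`, i.e. a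
subrepresentation. ("The condition that `E` has no `F`-rational 5-isogeny is equivalent to the
assertion that `ρ̄` is irreducible.") [cite: Thorne2016, proof of Thm. 7.6] -/
theorem hasIrreducibleModPGaloisRep_of_isIrreducible {F : Type u} [Field F]
    {W : WeierstrassCurve F} {p : ℕ} [Fact p.Prime] {ρ : FramedGaloisRep F (ZMod p) 2}
    (hρ : W.IsTorsionGaloisRep p ρ) (hirr : FramedRep.IsIrreducible ρ) :
    W.HasIrreducibleModPGaloisRep p := by
  obtain ⟨e, he⟩ := hρ
  intro H hH
  let S : Submodule (ZMod p) (Fin 2 → ZMod p) :=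
    AddSubgroup.toZModSubmodule p (H.map e.toAddMonoidHom)
  have hSmem : ∀ x, x ∈ S ↔ e.symm x ∈ H := fun x => by
    change x ∈ H.map e.toAddMonoidHom ↔ _
    constructor
    · rintro ⟨Q, hQ, rfl⟩
      change e.symm (e Q) ∈ H
      rw [e.symm_apply_apply]
      exact hQ
    · intro hx
      exact ⟨e.symm x, hx, e.apply_symm_apply x⟩
  let V : Subrepresentation ρ.toRepresentation :=
    { toSubmodule := S
      apply_mem_toSubmodule := fun σ x hx => by
        rw [hSmem] at hx
        rw [FramedRep.toRepresentation_apply_apply, hSmem]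
        have hx' : ((ρ σ : GL (Fin 2) (ZMod p)) : Matrix (Fin 2) (Fin 2) (ZMod p)) *ᵥ x =
            e (σ • e.symm x) := by
          rw [he σ (e.symm x), e.apply_symm_apply]
        rw [hx', e.symm_apply_apply]
        exact hH σ _ hx }
  rcases hirr.eq_bot_or_eq_top V with hV | hV
  · left
    refine (AddSubgroup.eq_bot_iff_forall _).mpr fun Q hQ => ?_
    have hQ' : e Q ∈ V.toSubmodule := by
      change e Q ∈ S
      rw [hSmem, e.symm_apply_apply]
      exact hQ
    rw [hV] at hQ'
    change e Q ∈ (⊥ : Submodule (ZMod p) (Fin 2 → ZMod p)) at hQ'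
    rw [Submodule.mem_bot] at hQ'
    exact (map_eq_zero_iff e e.injective).1 hQ'
  · right
    refine (AddSubgroup.eq_top_iff' _).mpr fun Q => ?_
    have hQ' : e Q ∈ V.toSubmodule := by
      rw [hV]
      change e Q ∈ (⊤ : Submodule (ZMod p) (Fin 2 → ZMod p))
      exact Submodule.mem_top
    change e Q ∈ S at hQ'
    rw [hSmem, e.symm_apply_apply] at hQ'
    exact hQ'

end Thorne2016

/-! ### Theorem 7.6 and the named fact, modulo the two lifting theorems -/

/-- **Thorne 2016, Theorem 7.6 (= Thorne 2019, Thm. 2, second alternative), by its printed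
proof, from [Fre13] = `FLS2015_theorem3` and Theorem 7.5 = hypothesis (T).** For `F` a totally
real number field with `√5 ∉ F` (`¬ IsSquare (5 : F)`) and `E / 𝓞 F` with `Δ(E) ≠ 0` and no
`F`-rational `5`-isogeny (`HasIrreducibleModPGaloisRep 5`), `E` is automorphic of weight zero.
Proof as printed (module docstring): if `ρ̄_{E,5}(G_{F(ζ₅)})` is absolutely irreducible for all
framings and models (`ModPImageAbsIrreducibleOverCyclotomic`), FLS Thm. 3 (`h3`); otherwise fix a
framing `ρ̄` and a model `L` with `ρ̄|_{Γ_L}` absolutely reducible; `ρ̄` is absolutely irreducible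
(`Thorne2016.isAbsolutelyIrreducible_of_hasIrreducibleModPGaloisRep`), `ρ̄|_{Γ_L}` is a sum of two
distinct characters (`Thorne2016.exists_conj_restrictField_mem_diagonalSubgroup`), the quadratic
subfield `F(√5)` of `F(ζ₅)/F` is totally real (`Thorne2016.exists_isTotallyReal_quadratic_five`),
and Theorem 7.5 — the hypothesis `hT`, written out as (T) of the module docstring — applies at
`p = 5`. [cite: Thorne2016, Thm. 7.6 and its proof, Thm. 7.5] [cite: Thorne2019, Thm. 2 (proof: "[Tho15]")] -/
theorem Thorne2016_theorem7_6_of_dihedralLifting (h3 : FLS2015_theorem3)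
    (hT : ∀ (F : Type) [Field F] [NumberField F] [IsTotallyReal F] (p : ℕ) [Fact p.Prime], p ≠ 2 →
      ∀ (E : WeierstrassCurve (𝓞 F)), E.Δ ≠ 0 →
        ∀ ρ : ModPGaloisRep F (ZMod p) 2, (E.baseChange F).IsTorsionGaloisRep p ρ →
          FramedRep.IsAbsolutelyIrreducible ρ →
          ∀ (L : Type) [Field L] [Algebra F L] [IsCyclotomicExtension {p} F L],
            (∃ (k : Type) (_ : Field k) (f : ZMod p →+* k) (Q : GL (Fin 2) k),
                (∀ τ : absoluteGaloisGroup L,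
                  Q * Matrix.GeneralLinearGroup.map f (FramedGaloisRep.restrictField L ρ τ) * Q⁻¹ ∈
                    Serre1972.diagonalSubgroup k) ∧
                ∃ τ : absoluteGaloisGroup L,
                  ((Q * Matrix.GeneralLinearGroup.map f (FramedGaloisRep.restrictField L ρ τ) *
                      Q⁻¹ : GL (Fin 2) k) : Matrix (Fin 2) (Fin 2) k) 0 0 ≠
                    ((Q * Matrix.GeneralLinearGroup.map f (FramedGaloisRep.restrictField L ρ τ) *
                      Q⁻¹ : GL (Fin 2) k) : Matrix (Fin 2) (Fin 2) k) 1 1) →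
            (∃ (M : Type) (_ : Field M) (_ : Algebra F M),
                Module.finrank F M = 2 ∧ IsTotallyReal M ∧ Nonempty (M →ₐ[F] L)) →
            IsAutomorphicOfWeightZero E)
    (F : Type) [Field F] [NumberField F] [IsTotallyReal F] (h5 : ¬ IsSquare (5 : F))
    (E : WeierstrassCurve (𝓞 F)) (hΔ : E.Δ ≠ 0)
    (hirr : (E.baseChange F).HasIrreducibleModPGaloisRep 5) : IsAutomorphicOfWeightZero E := by
  haveI : Fact (Nat.Prime 5) := ⟨by norm_num⟩
  haveI := FLS2015.isElliptic_baseChange hΔ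
  by_cases himg : ModPImageAbsIrreducibleOverCyclotomic (E.baseChange F) 5
  · exact h3 F E hΔ 5 (Or.inr rfl) himg
  obtain ⟨ρ, hρ, L, _, _, _, hred⟩ :
      ∃ ρ : ModPGaloisRep F (ZMod 5) 2, (E.baseChange F).IsTorsionGaloisRep 5 ρ ∧
        ∃ (L : Type) (_ : Field L) (_ : Algebra F L) (_ : IsCyclotomicExtension {5} F L),
          ¬ FramedRep.IsAbsolutelyIrreducible (FramedGaloisRep.restrictField L ρ) := by
    by_contra hall
    push Not at hall
    refine himg ?_
    intro ρ hρ L _ _ _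
    exact hall ρ hρ L inferInstance inferInstance inferInstance
  have habs : FramedRep.IsAbsolutelyIrreducible ρ :=
    Thorne2016.isAbsolutelyIrreducible_of_hasIrreducibleModPGaloisRep (E.baseChange F)
      (by norm_num) hirr hρ
  have hdet : ∀ σ, Matrix.GeneralLinearGroup.det (ρ σ) = modPCyclotomicCharacterZMod F 5 σ :=
    (E.baseChange F).det_eq_modPCyclotomicCharacter_of_isTorsionGaloisRep_holds 5 ρ hρ
  obtain ⟨k, _, f, Q, hdiag, hdist⟩ :=
    Thorne2016.exists_conj_restrictField_mem_diagonalSubgroup ρ hdet habs L hred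
  exact hT F 5 (by norm_num) E hΔ ρ hρ habs L ⟨k, inferInstance, f, Q, hdiag, hdist⟩
    (Thorne2016.exists_isTotallyReal_quadratic_five F h5 L)

/-- **The named fact from Thm. 7.6 on the strong carrier.** Any proof of Thorne 2016, Thm. 7.6 in
the form "`F` totally real, `√5 ∉ F`, `E / 𝓞 F` with `Δ ≠ 0` and `E[5]` irreducible ⇒
`IsAutomorphicOfWeightZero E`" yields `Thorne2019_thm2_five` (whose conclusion is the trace-only
`IsModularEllipticCurve`, via the proved bridges `IsHilbertModular.of_isAutomorphicOfWeightZero`,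
`IsHilbertModular.isModularEllipticCurve`, and whose `IsTotallyReal K` is an explicit hypothesis).
[cite: Thorne2019, Thm. 2 (second alternative)] -/
theorem Thorne2019_thm2_five_of_theorem7_6
    (h76 : ∀ (F : Type) [Field F] [NumberField F] [IsTotallyReal F], ¬ IsSquare (5 : F) →
      ∀ E : WeierstrassCurve (𝓞 F), E.Δ ≠ 0 → (E.baseChange F).HasIrreducibleModPGaloisRep 5 →
        IsAutomorphicOfWeightZero E) :
    Thorne2019_thm2_five := by
  intro K _ _ hK h5 E hΔ hirr
  haveI := hK
  exact (IsHilbertModular.of_isAutomorphicOfWeightZero hΔ (h76 K h5 E hΔ hirr)).isModularEllipticCurve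

/-- **`Thorne2019_thm2_five` closed modulo its two printed inputs**: FLS 2015, Thm. 3
(`FLS2015_theorem3`) and Thorne 2016, Thm. 7.5 for `ρ_{E,p}` (hypothesis (T) of the module
docstring, written out). Composition of `Thorne2016_theorem7_6_of_dihedralLifting` and
`Thorne2019_thm2_five_of_theorem7_6`. [cite: Thorne2019, Thm. 2 and its proof] [cite: Thorne2016, Thms. 7.5, 7.6] -/
theorem Thorne2019_thm2_five_of_dihedralLifting (h3 : FLS2015_theorem3)
    (hT : ∀ (F : Type) [Field F] [NumberField F] [IsTotallyReal F] (p : ℕ) [Fact p.Prime], p ≠ 2 →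
      ∀ (E : WeierstrassCurve (𝓞 F)), E.Δ ≠ 0 →
        ∀ ρ : ModPGaloisRep F (ZMod p) 2, (E.baseChange F).IsTorsionGaloisRep p ρ →
          FramedRep.IsAbsolutelyIrreducible ρ →
          ∀ (L : Type) [Field L] [Algebra F L] [IsCyclotomicExtension {p} F L],
            (∃ (k : Type) (_ : Field k) (f : ZMod p →+* k) (Q : GL (Fin 2) k),
                (∀ τ : absoluteGaloisGroup L,
                  Q * Matrix.GeneralLinearGroup.map f (FramedGaloisRep.restrictField L ρ τ) * Q⁻¹ ∈
                    Serre1972.diagonalSubgroup k) ∧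
                ∃ τ : absoluteGaloisGroup L,
                  ((Q * Matrix.GeneralLinearGroup.map f (FramedGaloisRep.restrictField L ρ τ) *
                      Q⁻¹ : GL (Fin 2) k) : Matrix (Fin 2) (Fin 2) k) 0 0 ≠
                    ((Q * Matrix.GeneralLinearGroup.map f (FramedGaloisRep.restrictField L ρ τ) *
                      Q⁻¹ : GL (Fin 2) k) : Matrix (Fin 2) (Fin 2) k) 1 1) →
            (∃ (M : Type) (_ : Field M) (_ : Algebra F M),
                Module.finrank F M = 2 ∧ IsTotallyReal M ∧ Nonempty (M →ₐ[F] L)) →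
            IsAutomorphicOfWeightZero E) :
    Thorne2019_thm2_five :=
  Thorne2019_thm2_five_of_theorem7_6 fun F _ _ _ h5 E hΔ hirr =>
    Thorne2016_theorem7_6_of_dihedralLifting h3 hT F h5 E hΔ hirr

/-- **Box 2022, Thm. 1.3 (ii) ("(ii) Thorne 2016") from Thm. 7.6.** Any proof of Thorne 2016,
Thm. 7.6 on the strong carrier gives clause (ii) of `Box2022_theorem1_3`: a non-modular `E / 𝓞 K`
(`K` totally real, `Δ ≠ 0`, `¬ IsAutomorphicOfWeightZero E`) with `√5 ∉ K` has a framing of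
`E[5]` with image in the Borel subgroup `B(5)` — `E[5]` is then not irreducible, so a framing
(`exists_isTorsionGaloisRep`) is reducible (`Thorne2016.hasIrreducibleModPGaloisRep_of_isIrreducible`)
and becomes upper triangular after a change of framing
(`FLS2015.exists_isTorsionGaloisRep_borel_of_not_isIrreducible`). With
`Thorne2016_theorem7_6_of_dihedralLifting` this makes clause (ii) of `Box2022_theorem1_3` a
consequence of `FLS2015_theorem3` and (T), breaking the circularity recorded in Part I.
[cite: Box2022, Thm. 1.3 (ii)] [cite: Thorne2016, Thm. 7.6] -/
theorem Box2022_theorem1_3_five_of_theorem7_6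
    (h76 : ∀ (F : Type) [Field F] [NumberField F] [IsTotallyReal F], ¬ IsSquare (5 : F) →
      ∀ E : WeierstrassCurve (𝓞 F), E.Δ ≠ 0 → (E.baseChange F).HasIrreducibleModPGaloisRep 5 →
        IsAutomorphicOfWeightZero E)
    (K : Type) [Field K] [NumberField K] [IsTotallyReal K] (E : WeierstrassCurve (𝓞 K))
    (hΔ : E.Δ ≠ 0) (hne : ¬ IsAutomorphicOfWeightZero E) (h5 : ¬ IsSquare (5 : K)) :
    ∃ ρ : FramedGaloisRep K (ZMod 5) 2, (E.baseChange K).IsTorsionGaloisRep 5 ρ ∧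
      ∀ σ : absoluteGaloisGroup K,
        ((ρ σ : GL (Fin 2) (ZMod 5)) : Matrix (Fin 2) (Fin 2) (ZMod 5)) 1 0 = 0 := by
  haveI : Fact (Nat.Prime 5) := ⟨by norm_num⟩
  haveI := FLS2015.isElliptic_baseChange hΔ
  haveI : NeZero ((5 : ℕ) : K) := NeZero.charZero
  have hred : ¬ (E.baseChange K).HasIrreducibleModPGaloisRep 5 := fun hirr =>
    hne (h76 K h5 E hΔ hirr)
  obtain ⟨ρ, hρ⟩ := (E.baseChange K).exists_isTorsionGaloisRep 5
  have hnirr : ¬ FramedRep.IsIrreducible ρ := fun hirrρ =>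
    hred (Thorne2016.hasIrreducibleModPGaloisRep_of_isIrreducible hρ hirrρ)
  exact FLS2015.exists_isTorsionGaloisRep_borel_of_not_isIrreducible hρ hnirr

/-! ## Part III. The minimal printed inputs, at `p = 5` only

The assembly of Part II takes `FLS2015_theorem3` whole (`p ∈ {3, 5}`, every totally real `K`) and
Theorem 7.5 for every odd `p`. The printed proof of Thm. 7.6 uses strictly less: [Fre13] = FLS
Thm. 3 only at `p = 5`, only over fields with `√5 ∉ K` and only for curves without a `K`-rational
`5`-isogeny (first case), and Thm. 7.5 only at `p = 5` (second case), where moreover everything the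
proof has established by then is available to the lifting theorem: `√5 ∉ F`, `E[5]` irreducible,
the framing `ρ̄` absolutely irreducible with `det ρ̄ = χ̄₅` (Weil pairing), the model `L` of
`F(ζ₅)` with `ρ̄|_{Γ_L}` NOT absolutely irreducible, its dihedral shape (two distinct diagonal
characters after a base change, glue (2)) and the totally real quadratic subextension `F(√5) ⊂ L`
(glue (3)). `Thorne2016_theorem7_6_of_liftingAtFive` is the assembly from exactly these two
`p = 5` inputs, each written out with ALL of that data as antecedents — so that whichever carrier
of FLS Thm. 3 / Thorne Thm. 7.5 the tree eventually proves (any `p`, any of the equivalent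
phrasings of "residually dihedral") feeds it by specialisation — and
`Thorne2019_thm2_five_of_liftingAtFive` is the named fact from them; Part II is the special case
`h3 := FLS2015_theorem3`, `hT := (T)`. Also recorded: the variant of Part II taking the combined
fact `FLS2015_theorems3_4` (`FreitasLeHungSiksekLifting.lean`, the carrier grounding route
`SqrtFiveQuarticCovers`) in place of `FLS2015_theorem3`. -/

/-- **Thorne 2016, Thm. 7.6 from its two printed inputs at `p = 5`, in their weakest form.**
`h3` is FLS 2015, Thm. 3 sliced to what the first case of the printed proof uses: `K` totally
real, `√5 ∉ K`, `E / 𝓞 K` with `Δ ≠ 0` and `E[5]` irreducible, `p = 5`, and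
`ρ̄_{E,5}(G_{K(ζ₅)})` absolutely irreducible for all framings and models
(`ModPImageAbsIrreducibleOverCyclotomic`) ⇒ `IsAutomorphicOfWeightZero E`. `hT` is Thm. 7.5 for
`ρ_{E,5}` sliced to the second case, with every datum the printed proof has in hand as an
antecedent: `√5 ∉ F`, `p = 5`, `Δ ≠ 0`, `E[5]` irreducible, a framing `ρ̄` of `E[5]` that is
absolutely irreducible with `det ρ̄ = χ̄₅`, a model `L` of `F(ζ₅)` with `ρ̄|_{Γ_L}` not absolutely
irreducible, the dihedral shape of `ρ̄|_{Γ_L}` (diagonal with two distinct characters after a base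
change `f : 𝔽₅ → k` and conjugation by `Q ∈ GL₂(k)`), and a totally real quadratic subextension
of `L/F` ⇒ `IsAutomorphicOfWeightZero E`. Proof = the printed one (Part II), feeding `hT` all the
glue. [cite: Thorne2016, Thm. 7.6 and its proof, Thm. 7.5] [cite: FreitasLeHungSiksek2015, Thm. 3] -/
theorem Thorne2016_theorem7_6_of_liftingAtFive
    (h3 : ∀ (K : Type) [Field K] [NumberField K] [IsTotallyReal K], ¬ IsSquare (5 : K) →
      ∀ (E : WeierstrassCurve (𝓞 K)), E.Δ ≠ 0 → (E.baseChange K).HasIrreducibleModPGaloisRep 5 →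
        ∀ (p : ℕ) [Fact p.Prime], p = 5 →
          ModPImageAbsIrreducibleOverCyclotomic (E.baseChange K) p → IsAutomorphicOfWeightZero E)
    (hT : ∀ (F : Type) [Field F] [NumberField F] [IsTotallyReal F], ¬ IsSquare (5 : F) →
      ∀ (p : ℕ) [Fact p.Prime], p = 5 →
        ∀ (E : WeierstrassCurve (𝓞 F)), E.Δ ≠ 0 → (E.baseChange F).HasIrreducibleModPGaloisRep 5 →
          ∀ ρ : ModPGaloisRep F (ZMod p) 2, (E.baseChange F).IsTorsionGaloisRep p ρ →
            FramedRep.IsAbsolutelyIrreducible ρ →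
            (∀ σ, Matrix.GeneralLinearGroup.det (ρ σ) = modPCyclotomicCharacterZMod F p σ) →
            ∀ (L : Type) [Field L] [Algebra F L] [IsCyclotomicExtension {p} F L],
              ¬ FramedRep.IsAbsolutelyIrreducible (FramedGaloisRep.restrictField L ρ) →
              (∃ (k : Type) (_ : Field k) (f : ZMod p →+* k) (Q : GL (Fin 2) k),
                  (∀ τ : absoluteGaloisGroup L,
                    Q * Matrix.GeneralLinearGroup.map f (FramedGaloisRep.restrictField L ρ τ) *
                      Q⁻¹ ∈ Serre1972.diagonalSubgroup k) ∧
                  ∃ τ : absoluteGaloisGroup L,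
                    ((Q * Matrix.GeneralLinearGroup.map f (FramedGaloisRep.restrictField L ρ τ) *
                        Q⁻¹ : GL (Fin 2) k) : Matrix (Fin 2) (Fin 2) k) 0 0 ≠
                      ((Q * Matrix.GeneralLinearGroup.map f (FramedGaloisRep.restrictField L ρ τ) *
                        Q⁻¹ : GL (Fin 2) k) : Matrix (Fin 2) (Fin 2) k) 1 1) →
              (∃ (M : Type) (_ : Field M) (_ : Algebra F M),
                  Module.finrank F M = 2 ∧ IsTotallyReal M ∧ Nonempty (M →ₐ[F] L)) →
              IsAutomorphicOfWeightZero E)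
    (F : Type) [Field F] [NumberField F] [IsTotallyReal F] (h5 : ¬ IsSquare (5 : F))
    (E : WeierstrassCurve (𝓞 F)) (hΔ : E.Δ ≠ 0)
    (hirr : (E.baseChange F).HasIrreducibleModPGaloisRep 5) : IsAutomorphicOfWeightZero E := by
  haveI : Fact (Nat.Prime 5) := ⟨by norm_num⟩
  haveI := FLS2015.isElliptic_baseChange hΔ
  by_cases himg : ModPImageAbsIrreducibleOverCyclotomic (E.baseChange F) 5
  · exact h3 F h5 E hΔ hirr 5 rfl himg
  obtain ⟨ρ, hρ, L, _, _, _, hred⟩ :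
      ∃ ρ : ModPGaloisRep F (ZMod 5) 2, (E.baseChange F).IsTorsionGaloisRep 5 ρ ∧
        ∃ (L : Type) (_ : Field L) (_ : Algebra F L) (_ : IsCyclotomicExtension {5} F L),
          ¬ FramedRep.IsAbsolutelyIrreducible (FramedGaloisRep.restrictField L ρ) := by
    by_contra hall
    push Not at hall
    refine himg ?_
    intro ρ hρ L _ _ _
    exact hall ρ hρ L inferInstance inferInstance inferInstance
  have habs : FramedRep.IsAbsolutelyIrreducible ρ :=
    Thorne2016.isAbsolutelyIrreducible_of_hasIrreducibleModPGaloisRep (E.baseChange F)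
      (by norm_num) hirr hρ
  have hdet : ∀ σ, Matrix.GeneralLinearGroup.det (ρ σ) = modPCyclotomicCharacterZMod F 5 σ :=
    (E.baseChange F).det_eq_modPCyclotomicCharacter_of_isTorsionGaloisRep_holds 5 ρ hρ
  exact hT F h5 5 rfl E hΔ hirr ρ hρ habs hdet L hred
    (Thorne2016.exists_conj_restrictField_mem_diagonalSubgroup ρ hdet habs L hred)
    (Thorne2016.exists_isTotallyReal_quadratic_five F h5 L)

/-- **`Thorne2019_thm2_five` from the two minimal `p = 5` inputs** of
`Thorne2016_theorem7_6_of_liftingAtFive` (FLS Thm. 3 and Thorne Thm. 7.5, each sliced to exactly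
what the printed proof of Thm. 7.6 uses), via `Thorne2019_thm2_five_of_theorem7_6`.
[cite: Thorne2019, Thm. 2 and its proof] [cite: Thorne2016, Thms. 7.5, 7.6] -/
theorem Thorne2019_thm2_five_of_liftingAtFive
    (h3 : ∀ (K : Type) [Field K] [NumberField K] [IsTotallyReal K], ¬ IsSquare (5 : K) →
      ∀ (E : WeierstrassCurve (𝓞 K)), E.Δ ≠ 0 → (E.baseChange K).HasIrreducibleModPGaloisRep 5 →
        ∀ (p : ℕ) [Fact p.Prime], p = 5 →
          ModPImageAbsIrreducibleOverCyclotomic (E.baseChange K) p → IsAutomorphicOfWeightZero E)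
    (hT : ∀ (F : Type) [Field F] [NumberField F] [IsTotallyReal F], ¬ IsSquare (5 : F) →
      ∀ (p : ℕ) [Fact p.Prime], p = 5 →
        ∀ (E : WeierstrassCurve (𝓞 F)), E.Δ ≠ 0 → (E.baseChange F).HasIrreducibleModPGaloisRep 5 →
          ∀ ρ : ModPGaloisRep F (ZMod p) 2, (E.baseChange F).IsTorsionGaloisRep p ρ →
            FramedRep.IsAbsolutelyIrreducible ρ →
            (∀ σ, Matrix.GeneralLinearGroup.det (ρ σ) = modPCyclotomicCharacterZMod F p σ) →
            ∀ (L : Type) [Field L] [Algebra F L] [IsCyclotomicExtension {p} F L],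
              ¬ FramedRep.IsAbsolutelyIrreducible (FramedGaloisRep.restrictField L ρ) →
              (∃ (k : Type) (_ : Field k) (f : ZMod p →+* k) (Q : GL (Fin 2) k),
                  (∀ τ : absoluteGaloisGroup L,
                    Q * Matrix.GeneralLinearGroup.map f (FramedGaloisRep.restrictField L ρ τ) *
                      Q⁻¹ ∈ Serre1972.diagonalSubgroup k) ∧
                  ∃ τ : absoluteGaloisGroup L,
                    ((Q * Matrix.GeneralLinearGroup.map f (FramedGaloisRep.restrictField L ρ τ) *
                        Q⁻¹ : GL (Fin 2) k) : Matrix (Fin 2) (Fin 2) k) 0 0 ≠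
                      ((Q * Matrix.GeneralLinearGroup.map f (FramedGaloisRep.restrictField L ρ τ) *
                        Q⁻¹ : GL (Fin 2) k) : Matrix (Fin 2) (Fin 2) k) 1 1) →
              (∃ (M : Type) (_ : Field M) (_ : Algebra F M),
                  Module.finrank F M = 2 ∧ IsTotallyReal M ∧ Nonempty (M →ₐ[F] L)) →
              IsAutomorphicOfWeightZero E) :
    Thorne2019_thm2_five :=
  Thorne2019_thm2_five_of_theorem7_6 fun F _ _ _ h5 E hΔ hirr =>
    Thorne2016_theorem7_6_of_liftingAtFive h3 hT F h5 E hΔ hirr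

/-- **Part II with the combined carrier `FLS2015_theorems3_4`** (FLS Thms. 3–4, `p ∈ {3, 5, 7}`,
`FreitasLeHungSiksekLifting.lean`) in place of `FLS2015_theorem3`: the named fact from that fact
and hypothesis (T). [cite: Thorne2019, Thm. 2 and its proof] [cite: FreitasLeHungSiksek2015, Thm. 3] -/
theorem Thorne2019_thm2_five_of_theorems3_4_of_dihedralLifting (h34 : FLS2015_theorems3_4)
    (hT : ∀ (F : Type) [Field F] [NumberField F] [IsTotallyReal F] (p : ℕ) [Fact p.Prime], p ≠ 2 →
      ∀ (E : WeierstrassCurve (𝓞 F)), E.Δ ≠ 0 →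
        ∀ ρ : ModPGaloisRep F (ZMod p) 2, (E.baseChange F).IsTorsionGaloisRep p ρ →
          FramedRep.IsAbsolutelyIrreducible ρ →
          ∀ (L : Type) [Field L] [Algebra F L] [IsCyclotomicExtension {p} F L],
            (∃ (k : Type) (_ : Field k) (f : ZMod p →+* k) (Q : GL (Fin 2) k),
                (∀ τ : absoluteGaloisGroup L,
                  Q * Matrix.GeneralLinearGroup.map f (FramedGaloisRep.restrictField L ρ τ) * Q⁻¹ ∈
                    Serre1972.diagonalSubgroup k) ∧
                ∃ τ : absoluteGaloisGroup L,
                  ((Q * Matrix.GeneralLinearGroup.map f (FramedGaloisRep.restrictField L ρ τ) *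
                      Q⁻¹ : GL (Fin 2) k) : Matrix (Fin 2) (Fin 2) k) 0 0 ≠
                    ((Q * Matrix.GeneralLinearGroup.map f (FramedGaloisRep.restrictField L ρ τ) *
                      Q⁻¹ : GL (Fin 2) k) : Matrix (Fin 2) (Fin 2) k) 1 1) →
            (∃ (M : Type) (_ : Field M) (_ : Algebra F M),
                Module.finrank F M = 2 ∧ IsTotallyReal M ∧ Nonempty (M →ₐ[F] L)) →
            IsAutomorphicOfWeightZero E) :
    Thorne2019_thm2_five :=
  Thorne2019_thm2_five_of_liftingAtFive
    (fun K _ _ _ _ E hΔ _ p _ hp himg => h34 K E hΔ p (Or.inr (Or.inl hp)) himg)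
    (fun F _ _ _ _ p _ hp E hΔ _ ρ hρ habs _ L _ _ _ _ hdiag hM =>
      hT F p (by omega) E hΔ ρ hρ habs L hdiag hM)

end Literature.NumberTheory.Automorphic

end
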